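import Literature.NumberTheory.Automorphic.UnitaryGroupArchCayleyChart
import Mathlib.Analysis.Normed.Module.FiniteDimension
import Mathlib.LinearAlgebra.Determinant
import Mathlib.Topology.Algebra.Module.Determinant
import HarnessLib

/-!
# The Jacobian cocycle of the Cayley chart of `U(J)(E ⊗ ℝ)`: the linear maps `m_Y : H ↦ (1 − Y) H (1 + Y)` on `𝔲`, the
# weight `w₀(Y) = |det m_Y|_𝔲|⁻¹`, the transition maps `τ_k = ĉ⁻¹ ∘ (k ·) ∘ ĉ` and the identity `|det Dτ_k(X)| · w₀(τ_k X) = w₀(X)`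
(Weyl, *The Classical Groups* (1939), Ch. II §10; Helgason, *Groups and Geometric Analysis* (2000), Ch. I §1 Thm. 1.14; Knapp, *Lie Groups
Beyond an Introduction* (2002), Introduction §2, VIII §2.)

Topic `NumberTheory/Automorphic`; namespace `Literature.NumberTheory.Automorphic.UnitaryGroup`.  Definitions with bodies (`skewMulL`,
`cayleyWeight`, `cayleyTrans`, `cayleyTransSource`, `cayleyTransFDeriv`, `cayleyTransDeriv`) and proved theorems: no named fact, no instance,
no notation, no `sorry`.  Cell `hodgecm-mathlib`, F0∕P3 road «DM∞» (archimedean Dixmier–Malliavin, weak form, for `U(H)(L⁺ ⊗ ℝ)`; census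
`F0/P3/p03/CENSUS-DMinf.F0P3p03g8.md`), brick B5b, calculus half (over ★ `UnitaryGroupArchCayleyChart` p834931); the measure half is the
companion `UnitaryGroupArchCayleyHaar` (Haar measure of `U(J)(E ⊗ ℝ)` restricted to the chart window `= ĉ_*(w dX)`).

THE IDEA.  `ĉ_*(w dX)` is locally left-invariant iff `w(τ_k X) |det Dτ_k(X)| = w(X)` for the transition maps `τ_k = ĉ⁻¹ ∘ (k ·) ∘ ĉ`; the chain
rule gives `Dτ_k(X) ∘ m_X = m_{τ_k X}` with `m_Y : H ↦ (1 − Y) H (1 + Y)` (the derivative of left translation read in the chart, up to `Dĉ(0) = −2·id`),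
whence `w₀ = |det m_·|⁻¹`; the cocycle is proved here as a PURE ALGEBRAIC IDENTITY in `M` (§2: both sides are `4 g′ (1+g′)⁻¹ H (1+g′)⁻¹`).

CONTENT.
* §1 `skewMul_mem` (`(1−Y)H(1+Y) ∈ 𝔲` for `Y, H ∈ 𝔲`), **`skewMulL F E c N J Y : ↥𝔲 →L[ℝ] ↥𝔲`**, `coe_skewMulL_apply`, `finiteDimensional_matrix`,
  `continuous_skewMulL`, `skewMulL_injective` ∕ `det_skewMulL_ne_zero` (on the source), `continuous_det_skewMulL`, **`cayleyWeight F E c N J Y =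
  |det (skewMulL Y)|⁻¹`**, `cayleyWeight_pos`, `continuousOn_cayleyWeight`;
* §2 **`cayleyTrans F E c N J k = cayleyInv ∘ (k ·) ∘ cayleyChart`**, `cayleyTransSource` (open), `coe_cayleyTrans` (`= c(k c(X))`),
  `cayleyChart_cayleyTrans`, `cayleyTrans_mem_cayleySource`, `cayleyTrans_inv_cayleyTrans` (`τ_{k⁻¹} ∘ τ_k = id`), `injOn_cayleyTrans`; the ambient
  derivative `cayleyTransFDeriv k u₁ u₂` with `hasFDerivAt_cayley_mul_cayley`, `cayleyTransFDeriv_apply` (`= 4 • u₂⁻¹ k u₁⁻¹ H u₁⁻¹ u₂⁻¹`) and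
  THE COCYCLE **`cayleyTransFDeriv_skewMul`**;
* §3 `exists_retraction_archSkew` (a continuous linear `P : M → 𝔲` with `P|_𝔲 = id`, to name derivatives of `𝔲`-valued maps),
  `isUnit_one_add_mul_cayley`, **`cayleyTransDeriv F E c N J P k X h : ↥𝔲 →L[ℝ] ↥𝔲`** (`= P ∘ Dτ ∘ ι`), **`hasFDerivAt_cayleyTrans`**,
  **`cayleyTransDeriv_comp_skewMulL`** (`Dτ_k(X) ∘ m_X = m_{τ_k X}` on `𝔲`), `det_cayleyTransDeriv_mul`, and the weight cocycle
  **`abs_det_cayleyTransDeriv_mul_cayleyWeight : |det Dτ_k(X)| · w₀(τ_k X) = w₀(X)`**.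

HONEST SCOPE.  Calculus in `M_N(E ⊗ ℝ)` and linear algebra on the finite-dimensional `𝔲` (Mathlib only, over ★ `CayleyTransform`); no manifold, no
measure yet.  HC_CM is proved only modulo the printed citations until rung 0 closes; this file discharges no printed statement (banked for B6∕B7).

## References
* H. Weyl, *The Classical Groups, their Invariants and Representations*, Princeton (1939), Ch. II §10. [Weyl1939]
* S. Helgason, *Groups and Geometric Analysis*, AMS Math. Surveys Monogr. 83 (2000), Ch. I §1, Thm. 1.14 p. 96. [Helgason2000]
* A. W. Knapp, *Lie Groups Beyond an Introduction*, 2nd ed., Birkhäuser (2002), Introduction §2; VIII §2 (Haar measure in coordinates). [Knapp2002]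
-/

set_option autoImplicit false

noncomputable section

open NumberField NumberField.mixedEmbedding Set Filter Topology Literature.Analysis.Calculus
open scoped Classical Matrix Matrix.Norms.Operator MatrixGroups

namespace Literature.NumberTheory.Automorphic

namespace UnitaryGroup

section Jacobian

variable (F E : Type) [Field F] [Field E] [NumberField E] [Algebra F E] (c : E ≃ₐ[F] E) (N : ℕ) (J : Matrix (Fin N) (Fin N) E)

variable {F E c N}

/-! ## §1 The linear maps `m_Y : H ↦ (1 − Y) H (1 + Y)` preserve `𝔲` -/

omit [NumberField E] in
/-- For `Y, H ∈ 𝔲`, `(1 − Y) H (1 + Y) ∈ 𝔲` (`((1−Y)H(1+Y))* J′ = (1+Y*)H*(1−Y*)J′ = −J′(1−Y)H(1+Y)` from `Y*J′ = −J′Y`,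
`H*J′ = −J′H`). [cite: Weyl1939, Ch. II §10] -/
theorem skewMul_mem {Y H : Matrix (Fin N) (Fin N) (mixedSpace E)} (hY : Y ∈ archSkew F E c N J) (hH : H ∈ archSkew F E c N J) :
    (1 - Y) * H * (1 + Y) ∈ archSkew F E c N J := by
  rw [mem_archSkew_iff] at hY hH ⊢
  have hY' : archStar F E c N Y * archFormOf E N J = -(archFormOf E N J * Y) := eq_neg_of_add_eq_zero_left hY
  have hH' : archStar F E c N H * archFormOf E N J = -(archFormOf E N J * H) := eq_neg_of_add_eq_zero_left hH
  rw [archStar_mul, archStar_mul, archStar_one_add, archStar_one_sub]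
  -- `(1 + Y*) (H* ((1 − Y*) J′)) + J′ (1−Y) H (1+Y) = 0`
  have e1 : (1 - archStar F E c N Y) * archFormOf E N J = archFormOf E N J * (1 + Y) := by
    rw [sub_mul, one_mul, hY', mul_add, mul_one, sub_neg_eq_add]
  have e2 : (1 + archStar F E c N Y) * archFormOf E N J = archFormOf E N J * (1 - Y) := by
    rw [add_mul, one_mul, hY', mul_sub, mul_one, ← sub_eq_add_neg]
  calc (1 + archStar F E c N Y) * (archStar F E c N H * (1 - archStar F E c N Y)) * archFormOf E N J +
        archFormOf E N J * ((1 - Y) * H * (1 + Y))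
      = (1 + archStar F E c N Y) * archStar F E c N H * ((1 - archStar F E c N Y) * archFormOf E N J) +
        archFormOf E N J * ((1 - Y) * H * (1 + Y)) := by simp only [mul_assoc]
    _ = (1 + archStar F E c N Y) * (archStar F E c N H * archFormOf E N J) * (1 + Y) +
        archFormOf E N J * ((1 - Y) * H * (1 + Y)) := by rw [e1]; simp only [mul_assoc]
    _ = -(((1 + archStar F E c N Y) * archFormOf E N J) * H * (1 + Y)) + archFormOf E N J * ((1 - Y) * H * (1 + Y)) := by
        rw [hH']; simp only [mul_neg, neg_mul, mul_assoc]
    _ = 0 := by rw [e2]; simp only [mul_assoc]; exact neg_add_cancel _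

variable (F E c N) in
/-- **`m_Y|_𝔲 : 𝔲 →L[ℝ] 𝔲`, `H ↦ (1 − Y) H (1 + Y)`** — the derivative at `0` of «left translation by `c(Y)` read in the Cayley chart»
(`Z ↦ c(c(Y) c(Z))`), as a continuous linear endomorphism of `𝔲`. [cite: Weyl1939, Ch. II §10] -/
def skewMulL (Y : archSkew F E c N J) : archSkew F E c N J →L[ℝ] archSkew F E c N J :=
  ((ContinuousLinearMap.mulLeftRight ℝ (Matrix (Fin N) (Fin N) (mixedSpace E))
      (1 - (Y : Matrix (Fin N) (Fin N) (mixedSpace E))) (1 + (Y : Matrix (Fin N) (Fin N) (mixedSpace E)))).comp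
    (archSkew F E c N J).subtypeL).codRestrict (archSkew F E c N J) fun H => skewMul_mem J Y.2 H.2

/-- `↑(m_Y H) = (1 − Y) H (1 + Y)`. [cite: Weyl1939, Ch. II §10] -/
@[simp] theorem coe_skewMulL_apply (Y H : archSkew F E c N J) :
    ((skewMulL F E c N J Y H : archSkew F E c N J) : Matrix (Fin N) (Fin N) (mixedSpace E)) =
      (1 - (Y : Matrix (Fin N) (Fin N) (mixedSpace E))) * (H : Matrix (Fin N) (Fin N) (mixedSpace E)) *
        (1 + (Y : Matrix (Fin N) (Fin N) (mixedSpace E))) :=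
  rfl

/-- `M_N(E ⊗ ℝ)` is finite-dimensional over `ℝ` (Mathlib `Module.Finite.matrix`, put in the context by hand: under the scoped
operator-norm structure the synthesised instance term is too large, cf. ★ `GLnCuspidalSpectrumSiegelProofs`). [cite: Knapp2002, Introduction §2] -/
theorem finiteDimensional_matrix : FiniteDimensional ℝ (Matrix (Fin N) (Fin N) (mixedSpace E)) := Module.Finite.matrix

/-- `Y ↦ m_Y|_𝔲` is continuous (into `𝔲 →L[ℝ] 𝔲`; finite dimension: continuity is checked vector by vector).
[cite: Weyl1939, Ch. II §10] -/
theorem continuous_skewMulL : Continuous (skewMulL F E c N J) := by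
  haveI : FiniteDimensional ℝ (Matrix (Fin N) (Fin N) (mixedSpace E)) := finiteDimensional_matrix
  refine (continuous_clm_apply (𝕜 := ℝ) (E := archSkew F E c N J) (F := archSkew F E c N J)).2 fun H => ?_
  refine Continuous.subtype_mk ?_ _
  change Continuous fun Y : archSkew F E c N J =>
    (1 - (Y : Matrix (Fin N) (Fin N) (mixedSpace E))) * (H : Matrix (Fin N) (Fin N) (mixedSpace E)) *
      (1 + (Y : Matrix (Fin N) (Fin N) (mixedSpace E)))
  exact ((continuous_const.sub continuous_subtype_val).mul continuous_const).mul (continuous_const.add continuous_subtype_val)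

/-- `m_Y|_𝔲` is injective when `1 ± Y` are invertible. [cite: Weyl1939, Ch. II §10] -/
theorem skewMulL_injective {Y : archSkew F E c N J} (h : Y ∈ cayleySource F E c N J) : Function.Injective (skewMulL F E c N J Y) := by
  obtain ⟨u, hu⟩ := id h.1
  obtain ⟨v, hv⟩ := id h.2
  intro H₁ H₂ e
  have e' := congrArg (fun Z : archSkew F E c N J => (Z : Matrix (Fin N) (Fin N) (mixedSpace E))) e
  simp only [coe_skewMulL_apply, ← hu, ← hv] at e'
  apply Subtype.ext
  have e'' := congrArg (fun Z => ((v⁻¹ : (Matrix (Fin N) (Fin N) (mixedSpace E))ˣ) : Matrix (Fin N) (Fin N) (mixedSpace E)) * Z *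
    ((u⁻¹ : (Matrix (Fin N) (Fin N) (mixedSpace E))ˣ) : Matrix (Fin N) (Fin N) (mixedSpace E))) e'
  simpa only [mul_assoc, Units.inv_mul_cancel_left, Units.mul_inv, mul_one] using e''

/-- `det m_Y|_𝔲 ≠ 0` when `1 ± Y` are invertible. [cite: Weyl1939, Ch. II §10] -/
theorem det_skewMulL_ne_zero {Y : archSkew F E c N J} (h : Y ∈ cayleySource F E c N J) : (skewMulL F E c N J Y).det ≠ 0 := by
  haveI : FiniteDimensional ℝ (Matrix (Fin N) (Fin N) (mixedSpace E)) := finiteDimensional_matrix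
  intro h0
  have h1 := (LinearMap.det_eq_zero_iff_ker_ne_bot (f := ((skewMulL F E c N J Y : archSkew F E c N J →L[ℝ] archSkew F E c N J) :
    archSkew F E c N J →ₗ[ℝ] archSkew F E c N J))).1 h0
  exact h1 (LinearMap.ker_eq_bot.2 (skewMulL_injective J h))

/-- `Y ↦ det m_Y|_𝔲` is continuous. [cite: Weyl1939, Ch. II §10] -/
theorem continuous_det_skewMulL : Continuous fun Y : archSkew F E c N J => (skewMulL F E c N J Y).det :=
  ContinuousLinearMap.continuous_det.comp (continuous_skewMulL J)

variable (F E c N) in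
/-- **THE CAYLEY WEIGHT** `w₀(Y) = |det m_Y|_𝔲|⁻¹` — the density (up to a constant) of Haar measure of `U(J)(E ⊗ ℝ)` in the
Cayley chart with respect to Lebesgue measure on `𝔲`. [cite: Weyl1939, Ch. II §10] -/
def cayleyWeight (Y : archSkew F E c N J) : ℝ := |(skewMulL F E c N J Y).det|⁻¹

/-- Unfolding of `cayleyWeight`. [cite: Weyl1939, Ch. II §10] -/
theorem cayleyWeight_def (Y : archSkew F E c N J) : cayleyWeight F E c N J Y = |(skewMulL F E c N J Y).det|⁻¹ := rfl

/-- The Cayley weight is positive on the source. [cite: Weyl1939, Ch. II §10] -/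
theorem cayleyWeight_pos {Y : archSkew F E c N J} (h : Y ∈ cayleySource F E c N J) : 0 < cayleyWeight F E c N J Y :=
  inv_pos.2 (abs_pos.2 (det_skewMulL_ne_zero J h))

/-- The Cayley weight is continuous on the source. [cite: Weyl1939, Ch. II §10] -/
theorem continuousOn_cayleyWeight : ContinuousOn (cayleyWeight F E c N J) (cayleySource F E c N J) := by
  refine ContinuousOn.inv₀ ((continuous_det_skewMulL J).abs.continuousOn) fun Y hY => ?_
  exact (abs_pos.2 (det_skewMulL_ne_zero J hY)).ne'

/-! ## §2 The transition maps `τ_k = ĉ⁻¹ ∘ (k ·) ∘ ĉ` of the Cayley chart and their derivatives -/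

variable (F E c N) in
/-- **The transition map** `τ_k : 𝔲 → 𝔲`, `τ_k X = cayleyInv (k · ĉ X)` («left translation by `k ∈ U(J)(E ⊗ ℝ)` read in the
Cayley chart»; meaningful on `cayleyTransSource k`). [cite: Weyl1939, Ch. II §10] -/
def cayleyTrans (k : arch F E c N J) (X : archSkew F E c N J) : archSkew F E c N J :=
  cayleyInv F E c N J (k * cayleyChart F E c N J X)

variable (F E c N) in
/-- The source of `τ_k`: chart points whose `k`-translate stays in the chart image. [cite: Weyl1939, Ch. II §10] -/
def cayleyTransSource (k : arch F E c N J) : Set (archSkew F E c N J) :=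
  cayleySource F E c N J ∩
    {X | IsUnit (1 + (((k * cayleyChart F E c N J X : arch F E c N J) : GL (Fin N) (mixedSpace E)) : Matrix (Fin N) (Fin N) (mixedSpace E)))}

omit [NumberField E] in
/-- Membership in the source of `τ_k`. [cite: Weyl1939, Ch. II §10] -/
theorem mem_cayleyTransSource_iff (k : arch F E c N J) (X : archSkew F E c N J) :
    X ∈ cayleyTransSource F E c N J k ↔ X ∈ cayleySource F E c N J ∧
      IsUnit (1 + (((k * cayleyChart F E c N J X : arch F E c N J) : GL (Fin N) (mixedSpace E)) : Matrix (Fin N) (Fin N) (mixedSpace E))) :=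
  Iff.rfl

/-- The source of `τ_k` is open. [cite: Weyl1939, Ch. II §10] -/
theorem isOpen_cayleyTransSource (k : arch F E c N J) : IsOpen (cayleyTransSource F E c N J k) := by
  have h := isOpen_cayleySource_inter_preimage J ((isOpen_setOf_isUnit_one_add_coe J).preimage (continuous_const_mul k))
  exact h

omit [NumberField E] in
/-- On its source, `τ_k X` read in `M_N(E ⊗ ℝ)` is `c(k · c(X))`. [cite: Weyl1939, Ch. II §10] -/
theorem coe_cayleyTrans {k : arch F E c N J} {X : archSkew F E c N J} (h : X ∈ cayleyTransSource F E c N J k) :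
    (cayleyTrans F E c N J k X : Matrix (Fin N) (Fin N) (mixedSpace E)) =
      cayley ((((k : arch F E c N J) : GL (Fin N) (mixedSpace E)) : Matrix (Fin N) (Fin N) (mixedSpace E)) *
        cayley (X : Matrix (Fin N) (Fin N) (mixedSpace E))) := by
  rw [cayleyTrans, coe_cayleyInv J h.2, Subgroup.coe_mul, Units.val_mul, coe_cayleyChart J h.1]

omit [NumberField E] in
/-- `ĉ (τ_k X) = k · ĉ X` on the source. [cite: Weyl1939, Ch. II §10] -/
theorem cayleyChart_cayleyTrans {k : arch F E c N J} {X : archSkew F E c N J} (h : X ∈ cayleyTransSource F E c N J k) :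
    cayleyChart F E c N J (cayleyTrans F E c N J k X) = k * cayleyChart F E c N J X := by
  rw [cayleyTrans, cayleyChart_cayleyInv J h.2]

omit [NumberField E] in
/-- `τ_k X` lies in the chart source. [cite: Weyl1939, Ch. II §10] -/
theorem cayleyTrans_mem_cayleySource {k : arch F E c N J} {X : archSkew F E c N J} (h : X ∈ cayleyTransSource F E c N J k) :
    cayleyTrans F E c N J k X ∈ cayleySource F E c N J :=
  cayleyInv_mem_cayleySource J h.2

omit [NumberField E] in
/-- **The cocycle of the transition maps**: `τ_{k⁻¹} (τ_k X) = X` on the source. [cite: Weyl1939, Ch. II §10] -/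
theorem cayleyTrans_inv_cayleyTrans {k : arch F E c N J} {X : archSkew F E c N J} (h : X ∈ cayleyTransSource F E c N J k) :
    cayleyTrans F E c N J k⁻¹ (cayleyTrans F E c N J k X) = X := by
  rw [cayleyTrans, cayleyChart_cayleyTrans J h, ← mul_assoc, inv_mul_cancel, one_mul, cayleyInv_cayleyChart J h.1]

omit [NumberField E] in
/-- `τ_k` is injective on its source. [cite: Weyl1939, Ch. II §10] -/
theorem injOn_cayleyTrans (k : arch F E c N J) : InjOn (cayleyTrans F E c N J k) (cayleyTransSource F E c N J k) := by
  intro X hX Y hY e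
  rw [← cayleyTrans_inv_cayleyTrans J hX, ← cayleyTrans_inv_cayleyTrans J hY, e]

/-- The derivative of `X ↦ c(k · c(X))` on `M_N(E ⊗ ℝ)` at `X` (chain rule: `Dc(k c X) ∘ (k ·) ∘ Dc(X)`), in terms of the units
`u₁ = 1 + X` and `u₂ = 1 + k c(X)`. [cite: Weyl1939, Ch. II §10] -/
def cayleyTransFDeriv (k : Matrix (Fin N) (Fin N) (mixedSpace E)) (u₁ u₂ : (Matrix (Fin N) (Fin N) (mixedSpace E))ˣ) :
    Matrix (Fin N) (Fin N) (mixedSpace E) →L[ℝ] Matrix (Fin N) (Fin N) (mixedSpace E) :=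
  (-(2 : ℝ) • ContinuousLinearMap.mulLeftRight ℝ (Matrix (Fin N) (Fin N) (mixedSpace E))
      ((u₂⁻¹ : (Matrix (Fin N) (Fin N) (mixedSpace E))ˣ) : Matrix (Fin N) (Fin N) (mixedSpace E))
      ((u₂⁻¹ : (Matrix (Fin N) (Fin N) (mixedSpace E))ˣ) : Matrix (Fin N) (Fin N) (mixedSpace E))).comp
    (k • (-(2 : ℝ) • ContinuousLinearMap.mulLeftRight ℝ (Matrix (Fin N) (Fin N) (mixedSpace E))
      ((u₁⁻¹ : (Matrix (Fin N) (Fin N) (mixedSpace E))ˣ) : Matrix (Fin N) (Fin N) (mixedSpace E))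
      ((u₁⁻¹ : (Matrix (Fin N) (Fin N) (mixedSpace E))ˣ) : Matrix (Fin N) (Fin N) (mixedSpace E))))

/-- The ambient map `X ↦ c(k · c(X))` has derivative `cayleyTransFDeriv k u₁ u₂` at `X` (`u₁ = 1 + X`, `u₂ = 1 + k c(X)` the units).
[cite: Weyl1939, Ch. II §10] -/
theorem hasFDerivAt_cayley_mul_cayley (k X : Matrix (Fin N) (Fin N) (mixedSpace E)) (h₁ : IsUnit (1 + X)) (h₂ : IsUnit (1 + k * cayley X)) :
    HasFDerivAt (fun Y : Matrix (Fin N) (Fin N) (mixedSpace E) => cayley (k * cayley Y)) (cayleyTransFDeriv k h₁.unit h₂.unit) X := by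
  unfold cayleyTransFDeriv
  exact (hasFDerivAt_cayley h₂).comp X ((hasFDerivAt_cayley h₁).const_mul k)

/-- Pointwise formula: `cayleyTransFDeriv k u₁ u₂ H = 4 • (u₂⁻¹ (k (u₁⁻¹ H u₁⁻¹)) u₂⁻¹)`. [cite: Weyl1939, Ch. II §10] -/
theorem cayleyTransFDeriv_apply (k : Matrix (Fin N) (Fin N) (mixedSpace E)) (u₁ u₂ : (Matrix (Fin N) (Fin N) (mixedSpace E))ˣ)
    (H : Matrix (Fin N) (Fin N) (mixedSpace E)) :
    cayleyTransFDeriv k u₁ u₂ H =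
      (4 : ℝ) • (((u₂⁻¹ : (Matrix (Fin N) (Fin N) (mixedSpace E))ˣ) : Matrix (Fin N) (Fin N) (mixedSpace E)) *
        (k * (((u₁⁻¹ : (Matrix (Fin N) (Fin N) (mixedSpace E))ˣ) : Matrix (Fin N) (Fin N) (mixedSpace E)) * H *
          ((u₁⁻¹ : (Matrix (Fin N) (Fin N) (mixedSpace E))ˣ) : Matrix (Fin N) (Fin N) (mixedSpace E)))) *
        ((u₂⁻¹ : (Matrix (Fin N) (Fin N) (mixedSpace E))ˣ) : Matrix (Fin N) (Fin N) (mixedSpace E))) := by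
  show ((-(2 : ℝ) • ContinuousLinearMap.mulLeftRight ℝ (Matrix (Fin N) (Fin N) (mixedSpace E))
      ((u₂⁻¹ : (Matrix (Fin N) (Fin N) (mixedSpace E))ˣ) : Matrix (Fin N) (Fin N) (mixedSpace E))
      ((u₂⁻¹ : (Matrix (Fin N) (Fin N) (mixedSpace E))ˣ) : Matrix (Fin N) (Fin N) (mixedSpace E))).comp
    (k • (-(2 : ℝ) • ContinuousLinearMap.mulLeftRight ℝ (Matrix (Fin N) (Fin N) (mixedSpace E))
      ((u₁⁻¹ : (Matrix (Fin N) (Fin N) (mixedSpace E))ˣ) : Matrix (Fin N) (Fin N) (mixedSpace E))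
      ((u₁⁻¹ : (Matrix (Fin N) (Fin N) (mixedSpace E))ˣ) : Matrix (Fin N) (Fin N) (mixedSpace E))))) H = _
  rw [ContinuousLinearMap.comp_apply, smul_apply, smul_apply, smul_apply]
  simp only [ContinuousLinearMap.mulLeftRight_apply, smul_eq_mul, mul_smul_comm, smul_mul_assoc, smul_smul, mul_assoc]
  norm_num

omit [NumberField E] in
/-- In `M_N(E ⊗ ℝ)`, `2 Z = (2 : ℝ) • Z`. [cite: Weyl1939, Ch. II §10] -/
theorem two_mul_eq_two_smul (Z : Matrix (Fin N) (Fin N) (mixedSpace E)) : 2 * Z = (2 : ℝ) • Z := by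
  rw [ofNat_smul_eq_nsmul ℝ 2, two_nsmul, two_mul]

/-- **THE JACOBIAN COCYCLE (ambient form)**: `Dτ_k(X) (m_X H) = m_{τ_k X} H` with `m_Y H = (1 − Y) H (1 + Y)` — pure algebra: both
sides equal `4 g′ u₂⁻¹ H u₂⁻¹` with `g′ = k c(X)`, `u₂ = 1 + g′` (`u₁⁻¹ (1 − X) = c(X)`, `(1 + X) u₁⁻¹ = 1`, `1 − c(g′) = 2 g′ u₂⁻¹`,
`1 + c(g′) = 2 u₂⁻¹`, `g′ u₂⁻¹ = u₂⁻¹ g′`). [cite: Weyl1939, Ch. II §10] -/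
theorem cayleyTransFDeriv_skewMul (k X : Matrix (Fin N) (Fin N) (mixedSpace E)) (u₁ u₂ : (Matrix (Fin N) (Fin N) (mixedSpace E))ˣ)
    (hu₁ : (u₁ : Matrix (Fin N) (Fin N) (mixedSpace E)) = 1 + X) (hu₂ : (u₂ : Matrix (Fin N) (Fin N) (mixedSpace E)) = 1 + k * cayley X)
    (H : Matrix (Fin N) (Fin N) (mixedSpace E)) :
    cayleyTransFDeriv k u₁ u₂ ((1 - X) * H * (1 + X)) = (1 - cayley (k * cayley X)) * H * (1 + cayley (k * cayley X)) := by
  have h₁ : IsUnit (1 + X) := ⟨u₁, hu₁⟩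
  have h₂ : IsUnit (1 + k * cayley X) := ⟨u₂, hu₂⟩
  have hi₁ : Ring.inverse (1 + X) = ((u₁⁻¹ : (Matrix (Fin N) (Fin N) (mixedSpace E))ˣ) : Matrix (Fin N) (Fin N) (mixedSpace E)) := by
    rw [← hu₁, Ring.inverse_unit]
  have hi₂ : Ring.inverse (1 + k * cayley X) =
      ((u₂⁻¹ : (Matrix (Fin N) (Fin N) (mixedSpace E))ˣ) : Matrix (Fin N) (Fin N) (mixedSpace E)) := by
    rw [← hu₂, Ring.inverse_unit]
  -- abbreviations
  set g' := k * cayley X with hg'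
  set v₁ := ((u₁⁻¹ : (Matrix (Fin N) (Fin N) (mixedSpace E))ˣ) : Matrix (Fin N) (Fin N) (mixedSpace E)) with hv₁
  set v₂ := ((u₂⁻¹ : (Matrix (Fin N) (Fin N) (mixedSpace E))ˣ) : Matrix (Fin N) (Fin N) (mixedSpace E)) with hv₂
  -- `u₁⁻¹ (1 − X) = c(X)` and `(1 + X) u₁⁻¹ = 1`
  have e1 : v₁ * (1 - X) = cayley X := by rw [← hi₁, cayley_eq_inverse_mul h₁]
  have e2 : (1 + X) * v₁ = 1 := by rw [hv₁, ← hu₁, Units.mul_inv]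
  -- `1 − c(g′) = 2 • (g′ u₂⁻¹)`, `1 + c(g′) = 2 • u₂⁻¹`, and `u₂⁻¹ g′ = g′ u₂⁻¹`
  have e3 : 1 - cayley g' = (2 : ℝ) • (g' * v₂) := by
    rw [one_sub_cayley h₂, hi₂, two_mul_eq_two_smul, smul_mul_assoc]
  have e4 : 1 + cayley g' = (2 : ℝ) • v₂ := by
    rw [one_add_cayley h₂, hi₂, two_mul_eq_two_smul]
  have e5 : v₂ * g' = g' * v₂ := by
    have hc : Commute g' (u₂ : Matrix (Fin N) (Fin N) (mixedSpace E)) := by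
      rw [hu₂]; exact (Commute.one_right _).add_right (Commute.refl _)
    exact (Commute.units_inv_right hc).eq.symm
  rw [cayleyTransFDeriv_apply, e3, e4]
  calc (4 : ℝ) • (v₂ * (k * (v₁ * ((1 - X) * H * (1 + X)) * v₁)) * v₂)
      = (4 : ℝ) • (v₂ * (k * ((v₁ * (1 - X)) * H * ((1 + X) * v₁))) * v₂) := by simp only [mul_assoc]
    _ = (4 : ℝ) • ((v₂ * g') * H * v₂) := by rw [e1, e2, mul_one, hg']; simp only [mul_assoc]
    _ = (4 : ℝ) • ((g' * v₂) * H * v₂) := by rw [e5]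
    _ = ((2 : ℝ) • (g' * v₂)) * H * ((2 : ℝ) • v₂) := by
        simp only [mul_smul_comm, smul_mul_assoc, smul_smul, mul_assoc]; norm_num

/-! ## §3 The transition maps as differentiable self-maps of `𝔲` and the determinant cocycle -/

/-- A continuous linear retraction `P : M_N(E ⊗ ℝ) → 𝔲` onto `𝔲` (`P|_𝔲 = id`; finite dimension). It is used only to NAME the derivative
of the `𝔲`-valued transition maps as an endomorphism of `𝔲`; nothing depends on the choice. [cite: Knapp2002, Introduction §2] -/
theorem exists_retraction_archSkew :
    ∃ P : Matrix (Fin N) (Fin N) (mixedSpace E) →L[ℝ] archSkew F E c N J, ∀ X : archSkew F E c N J, P X = X := by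
  haveI : FiniteDimensional ℝ (Matrix (Fin N) (Fin N) (mixedSpace E)) := finiteDimensional_matrix
  obtain ⟨g, hg⟩ := LinearMap.exists_leftInverse_of_injective (archSkew F E c N J).subtype
    (LinearMap.ker_eq_bot.2 Subtype.val_injective)
  refine ⟨LinearMap.toContinuousLinearMap g, fun X => ?_⟩
  have := LinearMap.congr_fun hg X
  simpa using this

omit [NumberField E] in
/-- On the source of `τ_k`, `1 + k · c(X)` is invertible (read in `M_N(E ⊗ ℝ)`). [cite: Weyl1939, Ch. II §10] -/
theorem isUnit_one_add_mul_cayley {k : arch F E c N J} {X : archSkew F E c N J} (h : X ∈ cayleyTransSource F E c N J k) :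
    IsUnit (1 + (((k : arch F E c N J) : GL (Fin N) (mixedSpace E)) : Matrix (Fin N) (Fin N) (mixedSpace E)) *
      cayley (X : Matrix (Fin N) (Fin N) (mixedSpace E))) := by
  have h2 : IsUnit (1 + (((k * cayleyChart F E c N J X : arch F E c N J) : GL (Fin N) (mixedSpace E)) : Matrix (Fin N) (Fin N) (mixedSpace E))) :=
    h.2
  rwa [Subgroup.coe_mul, Units.val_mul, coe_cayleyChart J h.1] at h2

variable (F E c N) in
/-- The derivative of `τ_k` at `X` as an endomorphism of `𝔲`: `P ∘ Dτ_k(X) ∘ ι` (`ι : 𝔲 ≤ M_N(E ⊗ ℝ)`, `P` a retraction).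
[cite: Weyl1939, Ch. II §10] -/
def cayleyTransDeriv (P : Matrix (Fin N) (Fin N) (mixedSpace E) →L[ℝ] archSkew F E c N J) (k : arch F E c N J) (X : archSkew F E c N J)
    (h : X ∈ cayleyTransSource F E c N J k) : archSkew F E c N J →L[ℝ] archSkew F E c N J :=
  P.comp ((cayleyTransFDeriv ((((k : arch F E c N J) : GL (Fin N) (mixedSpace E)) : Matrix (Fin N) (Fin N) (mixedSpace E)))
    h.1.1.unit (isUnit_one_add_mul_cayley J h).unit).comp (archSkew F E c N J).subtypeL)

/-- Unfolding of `cayleyTransDeriv` on vectors. [cite: Weyl1939, Ch. II §10] -/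
theorem cayleyTransDeriv_apply (P : Matrix (Fin N) (Fin N) (mixedSpace E) →L[ℝ] archSkew F E c N J) {k : arch F E c N J}
    {X : archSkew F E c N J} (h : X ∈ cayleyTransSource F E c N J k) (H : archSkew F E c N J) :
    cayleyTransDeriv F E c N J P k X h H =
      P (cayleyTransFDeriv ((((k : arch F E c N J) : GL (Fin N) (mixedSpace E)) : Matrix (Fin N) (Fin N) (mixedSpace E)))
        h.1.1.unit (isUnit_one_add_mul_cayley J h).unit (H : Matrix (Fin N) (Fin N) (mixedSpace E))) :=
  rfl

/-- **`τ_k` IS DIFFERENTIABLE on its (open) source, with derivative `cayleyTransDeriv P k X`** — chain rule through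
`M_N(E ⊗ ℝ)` (`τ_k = P ∘ (Y ↦ c(k c(Y))) ∘ ι` near `X`). [cite: Weyl1939, Ch. II §10] -/
theorem hasFDerivAt_cayleyTrans {P : Matrix (Fin N) (Fin N) (mixedSpace E) →L[ℝ] archSkew F E c N J} (hP : ∀ X : archSkew F E c N J, P X = X)
    {k : arch F E c N J} {X : archSkew F E c N J} (h : X ∈ cayleyTransSource F E c N J k) :
    HasFDerivAt (cayleyTrans F E c N J k) (cayleyTransDeriv F E c N J P k X h) X := by
  set kM := (((k : arch F E c N J) : GL (Fin N) (mixedSpace E)) : Matrix (Fin N) (Fin N) (mixedSpace E)) with hkM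
  -- the ambient composite `P ∘ (Y ↦ c(k c Y)) ∘ ι`
  have hamb : HasFDerivAt (fun Y : archSkew F E c N J => P (cayley (kM * cayley (Y : Matrix (Fin N) (Fin N) (mixedSpace E)))))
      (cayleyTransDeriv F E c N J P k X h) X := by
    have h1 := (hasFDerivAt_cayley_mul_cayley kM (X : Matrix (Fin N) (Fin N) (mixedSpace E)) h.1.1 (isUnit_one_add_mul_cayley J h)).comp X
      ((archSkew F E c N J).subtypeL.hasFDerivAt)
    exact P.hasFDerivAt.comp X h1
  refine hamb.congr_of_eventuallyEq ?_
  filter_upwards [(isOpen_cayleyTransSource J k).mem_nhds h] with Y hY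
  have e : (cayleyTrans F E c N J k Y : Matrix (Fin N) (Fin N) (mixedSpace E)) = cayley (kM * cayley (Y : Matrix (Fin N) (Fin N) (mixedSpace E))) :=
    coe_cayleyTrans J hY
  rw [← e]
  exact (hP _).symm

/-- **THE JACOBIAN COCYCLE on `𝔲`**: `Dτ_k(X) ∘ m_X = m_{τ_k X}` as endomorphisms of `𝔲`. [cite: Weyl1939, Ch. II §10] -/
theorem cayleyTransDeriv_comp_skewMulL {P : Matrix (Fin N) (Fin N) (mixedSpace E) →L[ℝ] archSkew F E c N J}
    (hP : ∀ X : archSkew F E c N J, P X = X) {k : arch F E c N J} {X : archSkew F E c N J} (h : X ∈ cayleyTransSource F E c N J k) :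
    (cayleyTransDeriv F E c N J P k X h).comp (skewMulL F E c N J X) = skewMulL F E c N J (cayleyTrans F E c N J k X) := by
  set kM := (((k : arch F E c N J) : GL (Fin N) (mixedSpace E)) : Matrix (Fin N) (Fin N) (mixedSpace E)) with hkM
  refine ContinuousLinearMap.ext fun H => Subtype.ext ?_
  -- the value `Dτ_k(X)(m_X H)` in `M_N(E ⊗ ℝ)` is `m_{τ_k X} H`, an element of `𝔲`
  have hmem : (1 - cayley (kM * cayley (X : Matrix (Fin N) (Fin N) (mixedSpace E)))) * (H : Matrix (Fin N) (Fin N) (mixedSpace E)) *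
      (1 + cayley (kM * cayley (X : Matrix (Fin N) (Fin N) (mixedSpace E)))) ∈ archSkew F E c N J := by
    rw [← coe_cayleyTrans J h]
    exact skewMul_mem J (cayleyTrans F E c N J k X).2 H.2
  have e1 : cayleyTransFDeriv kM h.1.1.unit (isUnit_one_add_mul_cayley J h).unit
      ((1 - (X : Matrix (Fin N) (Fin N) (mixedSpace E))) * (H : Matrix (Fin N) (Fin N) (mixedSpace E)) * (1 + (X : Matrix (Fin N) (Fin N) (mixedSpace E)))) =
      (1 - cayley (kM * cayley (X : Matrix (Fin N) (Fin N) (mixedSpace E)))) * (H : Matrix (Fin N) (Fin N) (mixedSpace E)) *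
        (1 + cayley (kM * cayley (X : Matrix (Fin N) (Fin N) (mixedSpace E)))) :=
    cayleyTransFDeriv_skewMul kM (X : Matrix (Fin N) (Fin N) (mixedSpace E)) _ _ h.1.1.unit_spec (isUnit_one_add_mul_cayley J h).unit_spec H
  have e2 : ((P ((1 - cayley (kM * cayley (X : Matrix (Fin N) (Fin N) (mixedSpace E)))) * (H : Matrix (Fin N) (Fin N) (mixedSpace E)) *
      (1 + cayley (kM * cayley (X : Matrix (Fin N) (Fin N) (mixedSpace E))))) : archSkew F E c N J) : Matrix (Fin N) (Fin N) (mixedSpace E)) =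
      (1 - cayley (kM * cayley (X : Matrix (Fin N) (Fin N) (mixedSpace E)))) * (H : Matrix (Fin N) (Fin N) (mixedSpace E)) *
        (1 + cayley (kM * cayley (X : Matrix (Fin N) (Fin N) (mixedSpace E)))) :=
    congrArg Subtype.val (hP ⟨_, hmem⟩)
  rw [ContinuousLinearMap.comp_apply, cayleyTransDeriv_apply, coe_skewMulL_apply, e1, e2, coe_skewMulL_apply, coe_cayleyTrans J h]

/-- **Determinant form of the cocycle**: `det Dτ_k(X) · det m_X = det m_{τ_k X}`. [cite: Weyl1939, Ch. II §10] -/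
theorem det_cayleyTransDeriv_mul {P : Matrix (Fin N) (Fin N) (mixedSpace E) →L[ℝ] archSkew F E c N J}
    (hP : ∀ X : archSkew F E c N J, P X = X) {k : arch F E c N J} {X : archSkew F E c N J} (h : X ∈ cayleyTransSource F E c N J k) :
    (cayleyTransDeriv F E c N J P k X h).det * (skewMulL F E c N J X).det = (skewMulL F E c N J (cayleyTrans F E c N J k X)).det := by
  rw [← cayleyTransDeriv_comp_skewMulL J hP h]
  exact (LinearMap.det_comp _ _).symm

/-- **THE WEIGHT COCYCLE**: `|det Dτ_k(X)| · w₀(τ_k X) = w₀(X)` on the source of `τ_k` — the identity that makes `ĉ_*(w₀ dX)`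
locally left-invariant (companion `UnitaryGroupArchCayleyHaar`). [cite: Weyl1939, Ch. II §10] -/
theorem abs_det_cayleyTransDeriv_mul_cayleyWeight {P : Matrix (Fin N) (Fin N) (mixedSpace E) →L[ℝ] archSkew F E c N J}
    (hP : ∀ X : archSkew F E c N J, P X = X) {k : arch F E c N J} {X : archSkew F E c N J} (h : X ∈ cayleyTransSource F E c N J k) :
    |(cayleyTransDeriv F E c N J P k X h).det| * cayleyWeight F E c N J (cayleyTrans F E c N J k X) = cayleyWeight F E c N J X := by
  have hd := det_cayleyTransDeriv_mul J hP h
  have h0' : (skewMulL F E c N J (cayleyTrans F E c N J k X)).det ≠ 0 := det_skewMulL_ne_zero J (cayleyTrans_mem_cayleySource J h)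
  have hA : (cayleyTransDeriv F E c N J P k X h).det ≠ 0 := by
    intro hz
    rw [hz, zero_mul] at hd
    exact h0' hd.symm
  rw [cayleyWeight_def, cayleyWeight_def, ← hd, abs_mul, mul_inv, ← mul_assoc, mul_inv_cancel₀ (abs_ne_zero.2 hA), one_mul]

end Jacobian

end UnitaryGroup

end Literature.NumberTheory.Automorphic
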